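import Literature.Computability.AlgebraicComplexity.Apolarity
import Mathlib.Algebra.MvPolynomial.PDeriv

/-!
# Apolarity API (cdisprove gen 2 by-product): bilinearity, multiplicativity, GL-equivariance, derivative rule, torus facts, closedness, W5 collapse
# and the collapse of the apolarity clause W5 to its top degree.
-/

namespace Summit.ValiantsHypothesis.ValiantsHypothesis.Cruxes.FixedWitnessObstructionQP.Disproof.Bilin

open Literature.Computability.AlgebraicComplexity
open MvPolynomial Filter
open scoped BigOperators Topology Matrix

set_option linter.dupNamespace false
set_option linter.unusedSectionVars false

noncomputable section

variable {σ : Type*} {k : Type*} [CommRing k] [DecidableEq σ]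

/-- The descending-factorial coefficient `c(d,e) = ∏_{i ∈ supp e} dᵢ!/(dᵢ−eᵢ)!`. -/
def dcoef (d e : σ →₀ ℕ) : k := ∏ i ∈ e.support, (Nat.descFactorial (d i) (e i) : k)

/-- `apolarAction` as an iterated `Finsupp.sum` over the coefficient functions. -/
theorem apolarAction_eq_sum (D f : MvPolynomial σ k) :
    apolarAction D f = (AddMonoidAlgebra.coeff D).sum (fun e a =>
      (AddMonoidAlgebra.coeff f).sum (fun d b => monomial (d - e) (a * b * dcoef d e))) :=
  rfl

/-! ## Bilinearity -/

theorem apolarAction_add_left (D E f : MvPolynomial σ k) :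
    apolarAction (D + E) f = apolarAction D f + apolarAction E f := by
  rw [apolarAction_eq_sum, apolarAction_eq_sum, apolarAction_eq_sum, AddMonoidAlgebra.coeff_add]
  apply Finsupp.sum_add_index'
  · intro e
    simp [Finsupp.sum]
  · intro e a₁ a₂
    simp only [Finsupp.sum, ← Finset.sum_add_distrib, ← map_add]
    refine Finset.sum_congr rfl fun d _ => ?_
    congr 1
    ring

theorem apolarAction_add_right (D f g : MvPolynomial σ k) :
    apolarAction D (f + g) = apolarAction D f + apolarAction D g := by
  rw [apolarAction_eq_sum, apolarAction_eq_sum, apolarAction_eq_sum, AddMonoidAlgebra.coeff_add,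
    ← Finsupp.sum_add]
  refine Finsupp.sum_congr fun e _ => ?_
  apply Finsupp.sum_add_index'
  · intro d
    simp
  · intro d b₁ b₂
    rw [← map_add]
    congr 1
    ring

theorem apolarAction_smul_left (c : k) (D f : MvPolynomial σ k) :
    apolarAction (c • D) f = c • apolarAction D f := by
  rw [apolarAction_eq_sum, apolarAction_eq_sum, AddMonoidAlgebra.coeff_smul, Finsupp.sum_smul_index']
  · simp only [Finsupp.sum, Finset.smul_sum, smul_monomial, smul_eq_mul]
    refine Finset.sum_congr rfl fun e _ => Finset.sum_congr rfl fun d _ => ?_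
    congr 1
    ring
  · intro e
    simp [Finsupp.sum]

theorem apolarAction_smul_right (c : k) (D f : MvPolynomial σ k) :
    apolarAction D (c • f) = c • apolarAction D f := by
  rw [apolarAction_eq_sum, apolarAction_eq_sum, AddMonoidAlgebra.coeff_smul, Finsupp.smul_sum]
  refine Finsupp.sum_congr fun e _ => ?_
  rw [Finsupp.sum_smul_index', Finsupp.smul_sum]
  · refine Finsupp.sum_congr fun d _ => ?_
    rw [smul_monomial, smul_eq_mul]
    congr 1
    ring
  · intro d
    simp

theorem apolarAction_sum_left {ι : Type*} (s : Finset ι) (D : ι → MvPolynomial σ k)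
    (f : MvPolynomial σ k) : apolarAction (∑ i ∈ s, D i) f = ∑ i ∈ s, apolarAction (D i) f := by
  classical
  induction s using Finset.induction_on with
  | empty => simp
  | insert a s ha ih => rw [Finset.sum_insert ha, Finset.sum_insert ha, apolarAction_add_left, ih]

theorem apolarAction_sum_right {ι : Type*} (s : Finset ι) (D : MvPolynomial σ k)
    (f : ι → MvPolynomial σ k) : apolarAction D (∑ i ∈ s, f i) = ∑ i ∈ s, apolarAction D (f i) := by
  classical
  induction s using Finset.induction_on with
  | empty => simp
  | insert a s ha ih => rw [Finset.sum_insert ha, Finset.sum_insert ha, apolarAction_add_right, ih]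

theorem apolarAction_sub_left (D E f : MvPolynomial σ k) :
    apolarAction (D - E) f = apolarAction D f - apolarAction E f := by
  rw [sub_eq_add_neg, apolarAction_add_left, ← neg_one_smul k E, apolarAction_smul_left, neg_one_smul,
    sub_eq_add_neg]

/-! ## Monomial formula and the derivative rule -/

theorem apolarAction_monomial_monomial' (e d : σ →₀ ℕ) (a b : k) :
    apolarAction (monomial e a) (monomial d b) = monomial (d - e) (a * b * dcoef d e) := by
  classical
  rw [apolarAction_monomial_monomial]
  rfl

/-- `c(d, e + eᵢ) = c(d, e) · (dᵢ − eᵢ)`, unconditionally. -/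
theorem dcoef_add_single (d e : σ →₀ ℕ) (i : σ) :
    (dcoef d (e + Finsupp.single i 1) : k) = dcoef d e * ((d i - e i : ℕ) : k) := by
  classical
  unfold dcoef
  set S := insert i e.support with hS
  have hsub1 : (e + Finsupp.single i 1).support ⊆ S := by
    intro j hj
    rw [hS, Finset.mem_insert]
    by_cases hji : j = i
    · exact Or.inl hji
    · right
      rw [Finsupp.mem_support_iff] at hj ⊢
      simpa [Finsupp.single_apply, Ne.symm hji] using hj
  have hsub2 : e.support ⊆ S := Finset.subset_insert _ _
  have h1 : ∏ j ∈ (e + Finsupp.single i 1).support,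
      ((Nat.descFactorial (d j) ((e + Finsupp.single i 1 : σ →₀ ℕ) j) : ℕ) : k) =
      ∏ j ∈ S, ((Nat.descFactorial (d j) ((e + Finsupp.single i 1 : σ →₀ ℕ) j) : ℕ) : k) :=
    Finset.prod_subset hsub1 fun j _ hj => by
      rw [Finsupp.notMem_support_iff] at hj
      rw [hj, Nat.descFactorial_zero, Nat.cast_one]
  have h2 : ∏ j ∈ e.support, ((Nat.descFactorial (d j) (e j) : ℕ) : k) =
      ∏ j ∈ S, ((Nat.descFactorial (d j) (e j) : ℕ) : k) :=
    Finset.prod_subset hsub2 fun j _ hj => by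
      rw [Finsupp.notMem_support_iff] at hj
      rw [hj, Nat.descFactorial_zero, Nat.cast_one]
  have hi : i ∈ S := Finset.mem_insert_self _ _
  rw [h1, h2, ← Finset.mul_prod_erase S _ hi, ← Finset.mul_prod_erase S _ hi]
  have h3 : ∏ j ∈ S.erase i, ((Nat.descFactorial (d j) ((e + Finsupp.single i 1 : σ →₀ ℕ) j) : ℕ) : k) =
      ∏ j ∈ S.erase i, ((Nat.descFactorial (d j) (e j) : ℕ) : k) := by
    refine Finset.prod_congr rfl fun j hj => ?_
    have hji : j ≠ i := Finset.ne_of_mem_erase hj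
    simp [hji.symm]
  rw [h3]
  simp only [Finsupp.add_apply, Finsupp.single_eq_same]
  rw [Nat.descFactorial_succ]
  push_cast
  ring

/-- **Derivative rule**: `(Xᵢ · D) ⌟ f = Xᵢ ⌟ (D ⌟ f)` (i.e. `∂ᵢ ∘ D(∂) = (∂ᵢ D)(∂)`). [folklore] -/
theorem apolarAction_X_mul (i : σ) (D f : MvPolynomial σ k) :
    apolarAction (X i * D) f = apolarAction (X i) (apolarAction D f) := by
  classical
  -- reduce to monomials by bilinearity
  conv_lhs => rw [as_sum D, as_sum f, Finset.mul_sum]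
  conv_rhs => rw [as_sum D, as_sum f]
  simp only [apolarAction_sum_left, apolarAction_sum_right]
  refine Finset.sum_congr rfl fun e _ => Finset.sum_congr rfl fun d _ => ?_
  rw [X, monomial_mul, apolarAction_monomial_monomial', apolarAction_monomial_monomial',
    apolarAction_monomial_monomial', one_mul, add_comm (Finsupp.single i 1), dcoef_add_single,
    tsub_tsub]
  congr 1
  have hc : ∀ u : σ →₀ ℕ, (dcoef u (Finsupp.single i 1) : k) = ((u i : ℕ) : k) := by
    intro u
    unfold dcoef
    rw [Finsupp.support_single _ one_ne_zero, Finset.prod_singleton, Finsupp.single_eq_same,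
      Nat.descFactorial_one]
  rw [hc, Finsupp.tsub_apply]
  ring

/-- Coefficients of `Xᵢ ⌟ g` (the partial derivative): `(Xᵢ ⌟ g)_u = (uᵢ + 1) g_{u + eᵢ}`. [folklore] -/
theorem coeff_apolarAction_X (i : σ) (g : MvPolynomial σ k) (u : σ →₀ ℕ) :
    coeff u (apolarAction (X i) g) = ((u i + 1 : ℕ) : k) * coeff (u + Finsupp.single i 1) g := by
  classical
  conv_lhs => rw [as_sum g]
  rw [apolarAction_sum_right, coeff_sum]
  simp only [X, apolarAction_monomial_monomial', one_mul, coeff_monomial]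
  have hc : ∀ d : σ →₀ ℕ, (dcoef d (Finsupp.single i 1) : k) = ((d i : ℕ) : k) := by
    intro d
    unfold dcoef
    rw [Finsupp.support_single _ one_ne_zero, Finset.prod_singleton, Finsupp.single_eq_same,
      Nat.descFactorial_one]
  simp only [hc]
  rw [Finset.sum_eq_single (u + Finsupp.single i 1)]
  · simp only [add_tsub_cancel_right, if_true, Finsupp.add_apply, Finsupp.single_eq_same]
    ring
  · intro d _ hne
    split_ifs with h
    · -- d - eᵢ = u but d ≠ u + eᵢ forces dᵢ = 0
      have hdi : d i = 0 := by
        by_contra hpos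
        apply hne
        ext j
        have := congrArg (fun f : σ →₀ ℕ => f j) h
        simp only [Finsupp.tsub_apply, Finsupp.single_apply] at this
        simp only [Finsupp.add_apply, Finsupp.single_apply]
        by_cases hji : i = j
        · subst hji; simp only [if_true] at this ⊢; omega
        · simp only [if_neg hji] at this ⊢; omega
      rw [hdi, Nat.cast_zero, mul_zero]
    · rfl
  · intro hn
    rw [if_pos (add_tsub_cancel_right _ _), notMem_support_iff.1 hn, zero_mul]

/-- A form of positive degree all of whose first partials vanish is zero (char 0). [folklore] -/
theorem eq_zero_of_forall_apolarAction_X [CharZero k] [IsDomain k] {g : MvPolynomial σ k} {j : ℕ}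
    (hg : g.IsHomogeneous j) (hj : 1 ≤ j) (h : ∀ i, apolarAction (X i) g = 0) : g = 0 := by
  classical
  by_contra hne
  obtain ⟨d, hd⟩ := ne_zero_iff.1 hne
  have hdeg : d.degree = j := by
    rw [Finsupp.degree_eq_weight_one]; exact hg hd
  obtain ⟨i, hi⟩ : ∃ i, d i ≠ 0 := by
    by_contra hcon
    push Not at hcon
    have : d = 0 := Finsupp.ext hcon
    rw [this, map_zero] at hdeg
    omega
  have key := congrArg (coeff (d - Finsupp.single i 1)) (h i)
  rw [coeff_apolarAction_X, coeff_zero] at key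
  have hsub : d - Finsupp.single i 1 + Finsupp.single i 1 = d := by
    apply tsub_add_cancel_of_le
    exact Finsupp.single_le_iff.2 (Nat.one_le_iff_ne_zero.2 hi)
  rw [hsub] at key
  rcases mul_eq_zero.1 key with h1 | h2
  · exact absurd h1 (Nat.cast_ne_zero.2 (Nat.succ_ne_zero _))
  · exact hd h2

/-- `apolarAction` of forms is a form: `deg (D ⌟ f) = deg f − deg D`. [folklore] -/
theorem apolarAction_isHomogeneous {D f : MvPolynomial σ k} {j m : ℕ} (hD : D.IsHomogeneous j)
    (hf : f.IsHomogeneous m) : (apolarAction D f).IsHomogeneous (m - j) := by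
  classical
  rw [apolarAction_def]
  refine IsHomogeneous.sum _ _ _ fun e he => IsHomogeneous.sum _ _ _ fun d hd => ?_
  by_cases hle : e ≤ d
  · apply isHomogeneous_monomial
    have hedeg : e.degree = j := by
      rw [Finsupp.degree_eq_weight_one]; exact hD (mem_support_iff.1 he)
    have hddeg : d.degree = m := by
      rw [Finsupp.degree_eq_weight_one]; exact hf (mem_support_iff.1 hd)
    have : (d - e).degree + e.degree = d.degree := by
      rw [← map_add, tsub_add_cancel_of_le hle]
    omega
  · have := apolarAction_monomial_monomial_of_not_le hle (coeff e D) (coeff d f)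
    rw [apolarAction_monomial_monomial] at this
    rw [this]
    exact isHomogeneous_zero _ _ _

/-! ## Collapse of the apolarity clause W5 to its top degree -/

/-- Multiplication by `Xᵢ` is coefficientwise continuous. [folklore] -/
theorem tendsto_coeffVec_X_mul {Ds : ℕ → MvPolynomial σ ℂ} {D : MvPolynomial σ ℂ} (i : σ)
    (h : Tendsto (fun t => coeffVec (Ds t)) atTop (𝓝 (coeffVec D))) :
    Tendsto (fun t => coeffVec (X i * Ds t)) atTop (𝓝 (coeffVec (X i * D))) := by
  classical
  rw [tendsto_pi_nhds] at h ⊢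
  intro u
  simp only [coeffVec_apply, coeff_X_mul']
  split_ifs with hu
  · exact h _
  · exact tendsto_const_nhds

/-- **W5 collapses to degree `m`.** For a border-apolarity limit `J` (Li ∧ Ls up to degree `m`)
and a form `g` of degree `m`: if `J_m ⌟ g = 0` then `J_j ⌟ g = 0` for every `j ≤ m`.  Reason: `J` is
stable under `D ↦ Xᵢ·D` (limits of ideals), `(Xᵢ D) ⌟ g = ∂ᵢ(D ⌟ g)`, and a form of positive degree
with all partials zero vanishes.  So the only apolarity information in a witness is ONE hyperplane
condition `J_m = g^⊥_m`. [folklore] -/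
theorem apolar_all_of_top {m : ℕ} {P : ℕ → MvPolynomial σ ℂ} {J : ℕ → Set (MvPolynomial σ ℂ)}
    (hJ : IsBorderApolarLimit m P J) {g : MvPolynomial σ ℂ} (hg : g.IsHomogeneous m)
    (htop : ∀ D ∈ J m, apolarAction D g = 0) :
    ∀ j ≤ m, ∀ D ∈ J j, apolarAction D g = 0 := by
  classical
  suffices H : ∀ r j, j + r = m → ∀ D ∈ J j, apolarAction D g = 0 by
    intro j hj D hD
    exact H (m - j) j (by omega) D hD
  intro r
  induction r with
  | zero =>
    intro j hj D hD
    rw [add_zero] at hj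
    subst hj
    exact htop D hD
  | succ r ih =>
    intro j hj D hD
    have hjm : j ≤ m := by omega
    have hDhom : D.IsHomogeneous j := hJ.isHomogeneous_of_mem hjm hD
    have hX : ∀ i, X i * D ∈ J (j + 1) := by
      intro i
      obtain ⟨Ds, hDs, hlim⟩ := hJ.exists_tendsto hjm hD
      refine hJ.mem_of_tendsto (k := j + 1) (by omega) (φ := id) (Ds := fun t => X i * Ds t)
        strictMono_id (fun t => ⟨?_, ?_⟩) (tendsto_coeffVec_X_mul i hlim)
      · have := (isHomogeneous_X ℂ i).mul (hDs t).1
        rwa [add_comm] at this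
      · change apolarAction (X i * Ds t) (P t) = 0
        rw [apolarAction_X_mul, (hDs t).2, apolarAction_zero_right]
    have hzero : ∀ i, apolarAction (X i) (apolarAction D g) = 0 := fun i => by
      rw [← apolarAction_X_mul]
      exact ih (j + 1) (by omega) _ (hX i)
    exact eq_zero_of_forall_apolarAction_X (apolarAction_isHomogeneous hDhom hg) (by omega) hzero

/-! ## `Xᵢ ⌟ ·` is the partial derivative; multiplicativity; GL-equivariance -/

section Equivariance

variable [Fintype σ]

omit [Fintype σ] in
/-- `C a ⌟ g = a • g`. [folklore] -/
theorem apolarAction_C (a : k) (g : MvPolynomial σ k) : apolarAction (C a) g = a • g := by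
  classical
  conv_lhs => rw [as_sum g]
  rw [apolarAction_sum_right]
  conv_rhs => rw [as_sum g, Finset.smul_sum]
  refine Finset.sum_congr rfl fun d _ => ?_
  rw [← monomial_zero', apolarAction_monomial_monomial', tsub_zero, smul_monomial, smul_eq_mul]
  congr 1
  unfold dcoef
  rw [Finsupp.support_zero, Finset.prod_empty, mul_one]

omit [Fintype σ] in
/-- `Xᵢ ⌟ g = ∂g/∂xᵢ` (Mathlib's `pderiv`). [folklore] -/
theorem apolarAction_X (i : σ) (g : MvPolynomial σ k) : apolarAction (X i) g = pderiv i g := by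
  classical
  conv_lhs => rw [as_sum g]
  conv_rhs => rw [as_sum g]
  rw [apolarAction_sum_right, map_sum]
  refine Finset.sum_congr rfl fun d _ => ?_
  rw [X, apolarAction_monomial_monomial', pderiv_monomial, one_mul]
  congr 1
  unfold dcoef
  rw [Finsupp.support_single _ one_ne_zero, Finset.prod_singleton, Finsupp.single_eq_same,
    Nat.descFactorial_one]

omit [Fintype σ] in
/-- **Multiplicativity**: `(D₁ D₂) ⌟ f = D₁ ⌟ (D₂ ⌟ f)` — `f ↦ D ⌟ f` is a `k[∂]`-module structure. [folklore] -/
theorem apolarAction_mul (D₁ D₂ f : MvPolynomial σ k) :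
    apolarAction (D₁ * D₂) f = apolarAction D₁ (apolarAction D₂ f) := by
  classical
  induction D₁ using MvPolynomial.induction_on generalizing D₂ with
  | C a =>
    rw [apolarAction_C, ← smul_eq_C_mul, apolarAction_smul_left]
  | add p q hp hq =>
    rw [add_mul, apolarAction_add_left, apolarAction_add_left, hp, hq]
  | mul_X p i hp =>
    rw [mul_comm p (X i), mul_assoc, apolarAction_X_mul, hp, ← apolarAction_X_mul]

/-- Chain rule for a single partial derivative through a linear substitution:
`∂ᵢ(g ∘ Aᵀ) = Σ_j A i j · (∂ⱼ g) ∘ Aᵀ`, i.e. `Xᵢ ⌟ (A·g) = A·((Aᵀ·Xᵢ) ⌟ g)`. [folklore] -/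
theorem pderiv_linSubst (A : Matrix σ σ k) (i : σ) (g : MvPolynomial σ k) :
    pderiv i (linSubst σ k A g) = ∑ j, A i j • linSubst σ k A (pderiv j g) := by
  classical
  induction g using MvPolynomial.induction_on with
  | C c =>
    simp
  | add p q hp hq =>
    simp only [map_add, hp, hq, smul_add, Finset.sum_add_distrib]
  | mul_X p l hp =>
    have h1 : pderiv i (linSubst σ k A (X l)) = C (A i l) := by
      rw [linSubst_X, map_sum, Finset.sum_eq_single i]
      · rw [Derivation.map_smul, pderiv_X, Pi.single_eq_same, smul_eq_C_mul, mul_one]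
      · intro j _ hji
        rw [Derivation.map_smul, pderiv_X, Pi.single_eq_of_ne hji, smul_zero]
      · intro h
        exact absurd (Finset.mem_univ i) h
    have lhs : pderiv i (linSubst σ k A (p * X l)) =
        A i l • linSubst σ k A p + linSubst σ k A (X l) * pderiv i (linSubst σ k A p) := by
      rw [map_mul, Derivation.leibniz, h1, smul_eq_mul, smul_eq_mul, mul_comm (linSubst σ k A p) (C _),
        ← smul_eq_C_mul]
    have hj : ∀ j, linSubst σ k A (pderiv j (p * X l)) =
        (if l = j then linSubst σ k A p else 0) + linSubst σ k A (X l) * linSubst σ k A (pderiv j p) := by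
      intro j
      rw [Derivation.leibniz, pderiv_X, smul_eq_mul, smul_eq_mul, map_add, map_mul, map_mul]
      congr 1
      simp only [Pi.single_apply]
      split_ifs with h <;> simp
    have rhs : (∑ j, A i j • linSubst σ k A (pderiv j (p * X l))) =
        A i l • linSubst σ k A p + linSubst σ k A (X l) * ∑ j, A i j • linSubst σ k A (pderiv j p) := by
      simp only [hj, smul_add, Finset.sum_add_distrib]
      congr 1
      · simp only [smul_ite, smul_zero, Finset.sum_ite_eq, Finset.mem_univ, if_true]
      · rw [Finset.mul_sum]
        refine Finset.sum_congr rfl fun j _ => ?_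
        rw [mul_smul_comm]
    rw [lhs, rhs, hp]

/-- **GL-equivariance of apolarity**: `D ⌟ (A·f) = A·((Aᵀ·D) ⌟ f)` for every matrix `A`
(`A·f = linSubst A f = f ∘ Aᵀ`).  In particular, for invertible `A`,
`Ann(A·f) = {D : Aᵀ·D ∈ Ann f}` — the transport rule behind W4 of the crux. [folklore] -/
theorem apolarAction_linSubst (A : Matrix σ σ k) (D f : MvPolynomial σ k) :
    apolarAction D (linSubst σ k A f) = linSubst σ k A (apolarAction (linSubst σ k Aᵀ D) f) := by
  classical
  induction D using MvPolynomial.induction_on generalizing f with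
  | C a =>
    rw [linSubst_C, apolarAction_C, apolarAction_C, map_smul]
  | add p q hp hq =>
    rw [apolarAction_add_left, map_add, apolarAction_add_left, map_add, hp, hq]
  | mul_X p i hp =>
    rw [mul_comm p (X i), apolarAction_X_mul, hp, apolarAction_X, pderiv_linSubst, map_mul,
      apolarAction_mul, linSubst_X, apolarAction_sum_left, map_sum]
    refine Finset.sum_congr rfl fun j _ => ?_
    rw [apolarAction_smul_left, map_smul, apolarAction_X, Matrix.transpose_apply]

/-- Hence, for invertible `A`: `D ∈ Ann(A·f) ↔ Aᵀ·D ∈ Ann(f)`. [folklore] -/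
theorem apolarAction_linSubst_eq_zero_iff (A : Matrix σ σ k) (hA : IsUnit A.det) (D f : MvPolynomial σ k) :
    apolarAction D (linSubst σ k A f) = 0 ↔ apolarAction (linSubst σ k Aᵀ D) f = 0 := by
  rw [apolarAction_linSubst]
  constructor
  · intro h
    have hinj : Function.Injective (linSubst σ k A) := by
      intro x y hxy
      have := congrArg (linSubst σ k A⁻¹) hxy
      simp only [← AlgHom.comp_apply, ← linSubst_mul, Matrix.nonsing_inv_mul _ hA, linSubst_one,
        AlgHom.id_apply] at this
      exact this
    exact hinj (h.trans (map_zero _).symm)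
  · intro h
    rw [h, map_zero]

end Equivariance


/-! ## Torus semi-invariance of `det` and torus stability of `Ann(det)`; closedness of `Ann_k` -/

section Torus

variable {K : Type*} [Field K] {ι : Type*} [Fintype ι] [DecidableEq ι]

/-- The rank-one diagonal substitution `x_{ij} ↦ aᵢ bⱼ x_{ij}`. -/
def torusDiag (a b : ι → K) : Matrix (ι × ι) (ι × ι) K := Matrix.diagonal fun p => a p.1 * b p.2

theorem torusDiag_transpose (a b : ι → K) : (torusDiag a b)ᵀ = torusDiag a b :=
  Matrix.diagonal_transpose _

theorem linSubst_torusDiag_X (a b : ι → K) (p : ι × ι) :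
    linSubst (ι × ι) K (torusDiag a b) (X p) = (a p.1 * b p.2) • X p := by
  classical
  rw [linSubst_X, Finset.sum_eq_single p]
  · simp [torusDiag]
  · intro q _ hq
    simp [torusDiag, Matrix.diagonal_apply_ne _ hq]
  · intro h; exact absurd (Finset.mem_univ p) h

/-- **Torus semi-invariance of the determinant**: `det(aᵢ bⱼ x_{ij}) = (∏ aᵢ)(∏ bⱼ) det(x)`. [folklore] -/
theorem linSubst_torusDiag_detPoly (a b : ι → K) :
    linSubst (ι × ι) K (torusDiag a b) (detPoly ι K) = ((∏ i, a i) * ∏ j, b j) • detPoly ι K := by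
  classical
  rw [detPoly, AlgHom.map_det]
  set X' : Matrix ι ι (MvPolynomial (ι × ι) K) := Matrix.mvPolynomialX ι ι K with hX'
  have hM : (linSubst (ι × ι) K (torusDiag a b)).mapMatrix X' =
      Matrix.diagonal (fun i => C (a i)) * X' * Matrix.diagonal (fun j => C (b j)) := by
    ext i j
    rw [AlgHom.mapMatrix_apply, Matrix.map_apply, Matrix.mul_diagonal, Matrix.diagonal_mul]
    simp only [hX', Matrix.mvPolynomialX_apply, linSubst_torusDiag_X, smul_eq_C_mul, map_mul]
    ring
  rw [hM, Matrix.det_mul, Matrix.det_mul, Matrix.det_diagonal, Matrix.det_diagonal, smul_eq_C_mul,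
    map_mul, map_prod, map_prod]
  ring

theorem isUnit_det_torusDiag {a b : ι → K} (ha : ∀ i, a i ≠ 0) (hb : ∀ j, b j ≠ 0) :
    IsUnit (torusDiag a b).det := by
  rw [torusDiag, Matrix.det_diagonal, isUnit_iff_ne_zero, Finset.prod_ne_zero_iff]
  intro p _
  exact mul_ne_zero (ha _) (hb _)

/-- **Torus stability of `Ann(det)`**: if `D ⌟ det = 0` then `(T·D) ⌟ det = 0` for every rank-one
diagonal scaling `T = diag(aᵢbⱼ)` with nonzero `a, b`. [folklore] -/
theorem apolarAction_torusDiag_detPoly {D : MvPolynomial (ι × ι) K}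
    (hD : apolarAction D (detPoly ι K) = 0) {a b : ι → K} (ha : ∀ i, a i ≠ 0) (hb : ∀ j, b j ≠ 0) :
    apolarAction (linSubst (ι × ι) K (torusDiag a b) D) (detPoly ι K) = 0 := by
  have h := apolarAction_linSubst_eq_zero_iff (torusDiag a b) (isUnit_det_torusDiag ha hb) D (detPoly ι K)
  rw [torusDiag_transpose] at h
  rw [← h, linSubst_torusDiag_detPoly, apolarAction_smul_right, hD, smul_zero]

end Torus

section Closed

variable {ι : Type*} [Fintype ι] [DecidableEq ι]

/-- A sum over the support of a degree-`j` form is a sum over all degree-`j` exponents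
(values in any additive commutative monoid). -/
theorem sum_support_eq_sum_deg' {A : Type*} [AddCommMonoid A] {j : ℕ} {D : MvPolynomial ι ℂ}
    (hD : D.IsHomogeneous j) (F : (ι →₀ ℕ) → A) (hF : ∀ d, coeff d D = 0 → F d = 0)
    [Fintype {d : ι →₀ ℕ // d.degree = j}] :
    ∑ d ∈ D.support, F d = ∑ d : {d : ι →₀ ℕ // d.degree = j}, F d.1 := by
  classical
  have hsub : D.support ⊆ (Finset.univ : Finset ι).finsuppAntidiag j := by
    intro d hd
    have : d.degree = j := by
      rw [Finsupp.degree_eq_weight_one]; exact hD (mem_support_iff.1 hd)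
    simp [Finset.mem_finsuppAntidiag, Finsupp.degree_eq_sum, ← this]
  rw [Finset.sum_subset hsub (fun d _ hd => hF d (notMem_support_iff.1 hd))]
  rw [← Finset.sum_subtype ((Finset.univ : Finset ι).finsuppAntidiag j)]
  intro d
  simp [Finset.mem_finsuppAntidiag, Finsupp.degree_eq_sum]

/-- The degree-`j` exponents form a finite type (local copy). -/
instance fintypeDeg' (j : ℕ) : Fintype {d : ι →₀ ℕ // d.degree = j} :=
  Fintype.subtype ((Finset.univ : Finset ι).finsuppAntidiag j) fun d => by
    simp [Finset.mem_finsuppAntidiag, Finsupp.degree_eq_sum]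

/-- A degree-`j` form is the sum of its degree-`j` terms over the finite type of exponents. -/
theorem eq_sum_deg {j : ℕ} {D : MvPolynomial ι ℂ} (hD : D.IsHomogeneous j) :
    D = ∑ d : {d : ι →₀ ℕ // d.degree = j}, monomial d.1 (coeff d.1 D) := by
  conv_lhs => rw [as_sum D]
  exact sum_support_eq_sum_deg' hD (fun d => monomial d (coeff d D)) (fun d hd => by rw [hd, map_zero])

/-- **Coefficients of `D ⌟ f` are continuous linear in the coefficients of a degree-`j` form `D`**:
`(D ⌟ f)_u = Σ_{|e| = j} D_e · (xᵉ ⌟ f)_u`. [folklore] -/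
theorem coeff_apolarAction_eq_sum_deg {j : ℕ} {D : MvPolynomial ι ℂ} (hD : D.IsHomogeneous j)
    (f : MvPolynomial ι ℂ) (u : ι →₀ ℕ) :
    coeff u (apolarAction D f) =
      ∑ e : {e : ι →₀ ℕ // e.degree = j}, coeff e.1 D * coeff u (apolarAction (monomial e.1 1) f) := by
  conv_lhs => rw [eq_sum_deg hD]
  rw [apolarAction_sum_left, coeff_sum]
  refine Finset.sum_congr rfl fun e _ => ?_
  rw [show monomial e.1 (coeff e.1 D) = coeff e.1 D • monomial e.1 (1 : ℂ) by
    rw [smul_monomial, smul_eq_mul, mul_one], apolarAction_smul_left, coeff_smul, smul_eq_mul]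

/-- **`Ann_j(f)` is closed under coefficientwise limits**: if forms `Ds t` of degree `j` annihilate
`f` and converge coefficientwise to `D`, then `D` is a form of degree `j` annihilating `f`.
(The W3 clause for a CONSTANT sequence.) [folklore] -/
theorem mem_annihilatorOfDegree_of_tendsto {j : ℕ} {f D : MvPolynomial ι ℂ} {Ds : ℕ → MvPolynomial ι ℂ}
    (hDs : ∀ t, Ds t ∈ annihilatorOfDegree f j)
    (hlim : Tendsto (fun t => coeffVec (Ds t)) atTop (𝓝 (coeffVec D))) :
    D ∈ annihilatorOfDegree f j := by
  -- homogeneity of the limit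
  have hhom : D.IsHomogeneous j := by
    have hcoeff : ∀ u : ι →₀ ℕ, u.degree ≠ j → coeff u D = 0 := by
      intro u hu
      have h1 : Tendsto (fun t => coeffVec (Ds t) u) atTop (𝓝 (coeffVec D u)) :=
        ((continuous_apply u).tendsto _).comp hlim
      have h2 : (fun t => coeffVec (Ds t) u) = fun _ => 0 := funext fun t => (hDs t).1.coeff_eq_zero hu
      rw [h2] at h1
      exact tendsto_nhds_unique h1 tendsto_const_nhds
    intro u hu
    by_contra hne
    exact hu (hcoeff u (by rwa [Finsupp.degree_eq_weight_one]))
  refine ⟨hhom, ?_⟩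
  -- each coefficient of `D ⌟ f` is the limit of the (zero) coefficients of `Ds t ⌟ f`
  ext u
  rw [coeff_zero, coeff_apolarAction_eq_sum_deg hhom]
  have hcont : Tendsto (fun t => ∑ e : {e : ι →₀ ℕ // e.degree = j},
      coeffVec (Ds t) e.1 * coeff u (apolarAction (monomial e.1 1) f)) atTop
      (𝓝 (∑ e : {e : ι →₀ ℕ // e.degree = j}, coeffVec D e.1 * coeff u (apolarAction (monomial e.1 1) f))) :=
    tendsto_finsetSum _ fun e _ => (((continuous_apply e.1).tendsto _).comp hlim).mul tendsto_const_nhds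
  have hzero : (fun t => ∑ e : {e : ι →₀ ℕ // e.degree = j},
      coeffVec (Ds t) e.1 * coeff u (apolarAction (monomial e.1 1) f)) = fun _ => 0 := by
    funext t
    have := congrArg (coeff u) (hDs t).2
    rw [coeff_apolarAction_eq_sum_deg (hDs t).1, coeff_zero] at this
    exact this
  rw [hzero] at hcont
  have := tendsto_nhds_unique tendsto_const_nhds hcont
  simpa only [coeffVec_apply] using this.symm

end Closed

end

end Summit.ValiantsHypothesis.ValiantsHypothesis.Cruxes.FixedWitnessObstructionQP.Disproof.Bilin
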